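import Mathlib
import Summits.ResolutionOfSingularities.ResolutionOfSingularities.Theorems.CleanModels.Negative.CossartPiltant2019Thm15iFrameOrdTowerCurveChartIdeal
import HarnessLib

/-!
# Towards `CurveBlowupFacts 5`: the local blowing ups of a curve blow-up are itself or `O` (CurveBlowupFacts (c))

Support file (INPUTS seat res-inputs-p-cp15frame g2, 2026-08-28) for the residual hypothesis `CurveBlowupFacts 5` of
`CossartPiltant2019_thm_1_5_i_frame_false_of_curveBlowupFacts` (RETIRED statement F-110, crux `CleanModels`,
stmt-ResolutionOfSingularities-15917).  For the curve blow-up `B♯ = R[v/u₀]_{centre}` along `O = ord_𝔪`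
(`…OrdTowerCurveChart`, `…OrdTowerCurveChartIdeal`: `𝔪_{B♯} = (u₀, w)`):

* `OrdWitness.eq_valuationSubring_of_isLocalBlowupAlong_maximalIdeal_of_range_le` — **blowing up the CLOSED POINT of any
  tower member containing `range (S → K)` and dominated by `O` gives `O`** (roadmap T3 generalised verbatim from the kind-`S`
  case `OrdWitness.eq_valuationSubring_of_isLocalBlowupAlong_maximalIdeal`: the chart generator has order `1` because
  `X₀ ∈ 𝔪`, and `a/b ∈ O` is `(a/u₀ᵐ)/(b/u₀ᵐ)`);
* `OrdWitness.ringKrullDim_Bsharp_le_two` — `dim B♯ ≤ 2` (Krull: `𝔪_{B♯}` is `2`-generated);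
* `eq_maximalIdeal_of_ringKrullDim_quotient_eq_zero` — a regular centre of codimension `dim` is the closed point;
* `OrdWitness.isLocalBlowupAlong_Bsharp` — **CurveBlowupFacts (c)**: a local blowing up of a regular `B♯` along a centre with
  regular quotient is `B♯` (the centre is principal: Matsumura 14.2 with `dim B♯ ≤ 2`, then the trivial step
  `eq_of_isLocalBlowupAlong_of_span_singleton`) or `O` (the centre is the closed point).

Nothing here proves or refutes resolution of singularities in characteristic `p`; [OURS · NEGATIVE-SUPPORT] counted 0.
-/

noncomputable section

set_option linter.dupNamespace false -- mandated namespace of this single-conjunct summit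

open MvPolynomial IsLocalRing
open Literature.AlgebraicGeometry.Resolution Literature.AlgebraicGeometry.Resolution.WeightedBlowup

namespace Summit.ResolutionOfSingularities.ResolutionOfSingularities.Theorems.CleanModels.Negative

/-- **A regular centre of codimension `dim A` is the closed point**: if `A/P` is a regular local ring of dimension `0` then
`P = 𝔪_A` (`emb dim A/P = 0`, so `A/P` is a field). [folklore] -/
theorem eq_maximalIdeal_of_ringKrullDim_quotient_eq_zero {A : Type} [CommRing A] [IsLocalRing A] {P : Ideal A}
    [IsRegularLocalRing (A ⧸ P)] (h : ringKrullDim (A ⧸ P) = 0) : P = maximalIdeal A := by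
  have hfield : IsField (A ⧸ P) := by
    rw [IsLocalRing.isField_iff_maximalIdeal_eq]
    have h1 := IsRegularLocalRing.spanFinrank_maximalIdeal (R := A ⧸ P)
    rw [h] at h1
    have h2 : (maximalIdeal (A ⧸ P)).spanFinrank = 0 := by exact_mod_cast h1
    exact (Submodule.spanFinrank_eq_zero_iff_eq_bot (maximalIdeal (A ⧸ P)).fg_of_isNoetherianRing).mp h2
  exact IsLocalRing.eq_maximalIdeal (Ideal.Quotient.maximal_of_isField P hfield)

namespace OrdWitness

variable (p : ℕ) [hp : Fact p.Prime]

/-! ## 1. Blowing up the closed point of a member containing `range (S → K)` gives `O` -/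

/-- **Roadmap T3, general member.**  Let `B` be a subring with `range (S → K) ≤ B ≤ O` which is local and its own localisation at
the centre of `O = ord_𝔪`.  If `B'` is a local blowing up of `B` along its maximal ideal with respect to `O`, then `B' = O`: the
chart generator `u₀` has order exactly `1` (`X₀ ∈ 𝔪_B` has order `1`, `u₀` has the least order in `𝔪_B`); a polynomial of order
`≥ m` lies in `(X)ᵐ`, whose image lies in `𝔪_Bᵐ`, so divided by `u₀ᵐ` it lies in `B[𝔪_B/u₀]`; hence `h = a/b ∈ O` (`ord a ≥ ord b = m`)
is `(a/u₀ᵐ)/(b/u₀ᵐ) ∈ B'`. [folklore] -/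
theorem eq_valuationSubring_of_isLocalBlowupAlong_maximalIdeal_of_range_le (B B' : Subring (K p)) (hRB : Rg p ≤ B)
    (hBO : B ≤ (O p).toSubring) (hfix : locAtCentre B (O p) = B) [IsLocalRing B] {P : Ideal B} (hP : P = maximalIdeal B)
    (H : IsLocalBlowupAlong (O p) B P B') : B' = (O p).toSubring := by
  have htarget : B' ≤ (O p).toSubring := H.isLocalBlowup.target_le
  obtain ⟨-, u, u₀, hspan, hu₀, hne, hval, rfl⟩ := H
  set C := Subring.closure ((B : Set (K p)) ∪ (fun x : B => (x : K p) / u₀) '' ↑u) with hC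
  have hequiv := Valuation.isEquiv_valuation_valuationSubring (ordVK p)
  have hdom : ∀ y : B, y ∈ maximalIdeal B ↔ ordVK p (y : K p) < 1 := fun y => by
    rw [mem_maximalIdeal_iff_valuation_lt_one hBO hfix y, valuation_O_lt_one_iff]
  -- the map `𝔽_p[X] → B` and its behaviour on `(X)`
  let ι : Poly p →+* B := (Subring.inclusion hRB).comp (toRange p)
  have hι : ∀ a : Poly p, ((ι a : B) : K p) = algebraMap (Poly p) (K p) a := fun a => coe_toRange p a
  have hιm : ∀ {a : Poly p}, a ∈ origin p → ι a ∈ maximalIdeal B := fun {a} ha => by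
    rw [hdom, hι, ordVK_algebraMap]
    exact ordV_lt_one_of_mem p ha
  -- `u₀` has order exactly `1`
  have hu₀m : u₀ ∈ maximalIdeal B := hP ▸ hspan ▸ Ideal.subset_span hu₀
  have hu₀lt : ordVK p (u₀ : K p) < 1 := (hdom u₀).mp hu₀m
  have hX0m : ι (X 0) ∈ Ideal.span (↑u : Set B) := by
    rw [hspan, hP]
    exact hιm (by rw [RingHom.mem_ker, constantCoeff_X])
  have hX0le := (valuation_span_le p hBO hval hX0m).1
  rw [hι] at hX0le
  have hu₀v : ordVK p (u₀ : K p) = expNeg 1 := by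
    apply eq_expNeg_one_of_le_of_lt _ hu₀lt
    rw [← ordVK_X0 p]
    exact (hequiv.le_iff_le).mpr hX0le
  have hu₀0 : (u₀ : K p) ≠ 0 := by
    intro e; have := hu₀v; rw [e, map_zero] at this; exact (expNeg_ne_zero 1) this.symm
  -- the ideals `J m = {y : 𝔽_p[X] | y / u₀ᵐ ∈ C}` contain `(X)ᵐ`
  let J : ℕ → Ideal (Poly p) := fun m =>
    { carrier := {y | algebraMap (Poly p) (K p) y / (u₀ : K p) ^ m ∈ C}
      add_mem' := fun {a b} ha hb => by
        show algebraMap (Poly p) (K p) (a + b) / (u₀ : K p) ^ m ∈ C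
        rw [map_add, add_div]; exact C.add_mem ha hb
      zero_mem' := by
        show algebraMap (Poly p) (K p) 0 / (u₀ : K p) ^ m ∈ C
        rw [map_zero, zero_div]; exact C.zero_mem
      smul_mem' := fun c {a} ha => by
        show algebraMap (Poly p) (K p) (c • a) / (u₀ : K p) ^ m ∈ C
        rw [smul_eq_mul, map_mul, mul_div_assoc]
        refine C.mul_mem (Subring.subset_closure (Or.inl ?_)) ha
        rw [← hι]; exact (ι c).2 }
  have hJmem : ∀ m (y : Poly p), y ∈ J m ↔ algebraMap (Poly p) (K p) y / (u₀ : K p) ^ m ∈ C := fun m y => Iff.rfl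
  have hJ0 : origin p ^ 0 ≤ J 0 := by
    intro y _
    rw [hJmem, pow_zero, div_one, ← hι]
    exact Subring.subset_closure (Or.inl (ι y).2)
  have hJ1 : origin p ≤ J 1 := by
    intro y hy
    rw [hJmem, pow_one, ← hι]
    have hy' : ι y ∈ Ideal.span (↑u : Set B) := by rw [hspan, hP]; exact hιm hy
    exact (valuation_span_le p hBO hval hy').2
  have hJmul : ∀ m n, J m * J n ≤ J (m + n) := by
    intro m n
    rw [Ideal.mul_le]
    intro r hr s hs
    rw [hJmem] at hr hs ⊢
    rw [map_mul, pow_add, ← div_mul_div_comm]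
    exact C.mul_mem hr hs
  have hJpow : ∀ m, origin p ^ m ≤ J m := by
    intro m
    induction m with
    | zero => exact hJ0
    | succ m ih => rw [pow_succ]; exact (Ideal.mul_mono ih hJ1).trans (hJmul m 1)
  -- `O ≤ B'`
  refine le_antisymm htarget fun h hh => ?_
  have hh1 : ordVK p h ≤ 1 := (mem_O_iff p h).mp hh
  obtain ⟨a, b, hb, rfl⟩ := IsFractionRing.div_surjective (A := Poly p) h
  have hb0 : b ≠ 0 := nonZeroDivisors.ne_zero hb
  by_cases ha0 : a = 0
  · rw [ha0, map_zero, zero_div]; exact zero_mem _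
  obtain ⟨m, hm⟩ := ENat.ne_top_iff_exists.mp (ord_ne_top p hb0)
  obtain ⟨n, hn⟩ := ENat.ne_top_iff_exists.mp (ord_ne_top p ha0)
  have hvb : ordVK p (algebraMap (Poly p) (K p) b) = expNeg m := by rw [ordVK_algebraMap, ordV_eq_expNeg p hb0 hm.symm]
  have hva : ordVK p (algebraMap (Poly p) (K p) a) = expNeg n := by rw [ordVK_algebraMap, ordV_eq_expNeg p ha0 hn.symm]
  have hmn : m ≤ n := by
    rw [map_div₀, hva, hvb, div_le_one₀ (pos_iff_ne_zero.mpr (expNeg_ne_zero m)), expNeg_le_expNeg] at hh1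
    exact hh1
  have haJ : a ∈ J m := hJpow m ((le_ord_iff_mem_origin_pow p a m).mp (by rw [← hn]; exact_mod_cast hmn))
  have hbJ : b ∈ J m := hJpow m ((le_ord_iff_mem_origin_pow p b m).mp (by rw [← hm]))
  rw [hJmem] at haJ hbJ
  have hden' : ordVK p (algebraMap (Poly p) (K p) b / (u₀ : K p) ^ m) = 1 := by
    rw [map_div₀, map_pow, hvb, hu₀v, expNeg_one_pow, div_self (expNeg_ne_zero m)]
  have hden : (O p).valuation (algebraMap (Poly p) (K p) b / (u₀ : K p) ^ m) = 1 :=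
    hequiv.eq_one_iff_eq_one.mp hden'
  refine ⟨_, haJ, _, hbJ, hden, ?_⟩
  rw [div_div_div_cancel_right₀ (pow_ne_zero _ hu₀0)]

/-! ## 2. `dim B♯ ≤ 2` and CurveBlowupFacts (c) -/

variable {p}
variable {x : Fin 3 → Rg p} (hx : Ideal.span (Set.range x) = maximalIdeal (Rg p))

include hx in
/-- **`dim B♯ ≤ 2`**: the maximal ideal `(u₀, w)` is `2`-generated (Krull). [folklore] -/
theorem ringKrullDim_Bsharp_le_two [IsRegularLocalRing (Bsharp p x)] : ringKrullDim (Bsharp p x) ≤ 2 := by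
  classical
  have hm := maximalIdeal_Bsharp_eq_span hx
  set s : Finset (Bsharp p x) := {xB x 0, xB x 2} with hs
  have hscoe : (↑s : Set (Bsharp p x)) = {xB x 0, xB x 2} := by rw [hs, Finset.coe_pair]
  have hsub : (↑s : Set (Bsharp p x)) ⊆ Ring.jacobson (Bsharp p x) := by
    rw [ringJacobson_eq_maximalIdeal, hscoe, hm]
    exact Ideal.subset_span
  have hspan : Ideal.span (↑s : Set (Bsharp p x)) = maximalIdeal (Bsharp p x) := by rw [hscoe, hm]
  have h := ringKrullDim_le_ringKrullDim_quotient_add_card s hsub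
  rw [hspan] at h
  have hq : ringKrullDim (Bsharp p x ⧸ maximalIdeal (Bsharp p x)) = 0 := by
    letI := Ideal.Quotient.field (maximalIdeal (Bsharp p x))
    exact ringKrullDim_eq_zero_of_field _
  rw [hq, zero_add] at h
  refine h.trans ?_
  have : s.card ≤ 2 := Finset.card_le_two
  exact_mod_cast this

include hx in
/-- **CurveBlowupFacts (c) for `B♯`**: a local blowing up of the regular local ring `B♯` along a centre `P'` with regular
quotient is `B♯` itself (if `P'` is not the closed point it is principal — Matsumura 14.2 with `dim B♯ ≤ 2` — and blowing up a
principal centre changes nothing) or `O` (if `P'` is the closed point). [folklore] -/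
theorem isLocalBlowupAlong_Bsharp [IsRegularLocalRing (Bsharp p x)] (P' : Ideal (Bsharp p x)) (B' : Subring (K p))
    (hreg : IsRegularLocalRing (Bsharp p x ⧸ P')) (H : IsLocalBlowupAlong (O p) (Bsharp p x) P' B') :
    B' = Bsharp p x ∨ B' = (O p).toSubring := by
  by_cases hmax : P' = maximalIdeal (Bsharp p x)
  · exact Or.inr (eq_valuationSubring_of_isLocalBlowupAlong_maximalIdeal_of_range_le p (Bsharp p x) B' range_le_Bsharp
      (Bsharp_le_O hx) locAtCentre_Bsharp hmax H)
  left
  haveI := hreg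
  have hPtop : P' ≠ ⊤ := by
    intro h
    haveI : Subsingleton (Bsharp p x ⧸ P') := Ideal.Quotient.subsingleton_iff.mpr h
    exact false_of_nontrivial_of_subsingleton (Bsharp p x ⧸ P')
  have hPle : P' ≤ maximalIdeal (Bsharp p x) := IsLocalRing.le_maximalIdeal hPtop
  obtain ⟨r, c, hc, hcP⟩ := exists_isRsopPart_span_range_eq hPle
  have hdim := hc.ringKrullDim_quotient_add
  rw [hcP] at hdim
  obtain ⟨k, hk⟩ := exists_nat_cast_eq_ringKrullDim (R := Bsharp p x ⧸ P')
  obtain ⟨d, hd⟩ := exists_nat_cast_eq_ringKrullDim (R := Bsharp p x)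
  rw [hk, hd] at hdim
  have hkr : k + r = d := by
    have : ((k + r : ℕ) : WithBot ℕ∞) = (d : WithBot ℕ∞) := by push_cast; exact hdim
    exact_mod_cast this
  have hd2 : d ≤ 2 := by
    have h2 := ringKrullDim_Bsharp_le_two hx
    rw [hd] at h2
    have : (d : WithBot ℕ∞) ≤ ((2 : ℕ) : WithBot ℕ∞) := h2
    exact_mod_cast this
  -- `r ≠ 0`: the centre is nonzero
  have hr0 : r ≠ 0 := by
    rintro rfl
    have hbot : P' = ⊥ := by rw [← hcP, Set.range_eq_empty, Ideal.span_empty]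
    obtain ⟨-, u', u₀', hspan', hu₀', hne', -, -⟩ := H
    have : u₀' ∈ P' := hspan' ▸ Ideal.subset_span hu₀'
    rw [hbot, Ideal.mem_bot] at this
    exact hne' this
  -- `r ≠ 2`: the centre is not the closed point
  have hr2 : r ≠ 2 := by
    rintro rfl
    have hk0 : k = 0 := by omega
    rw [hk0] at hk
    exact hmax (eq_maximalIdeal_of_ringKrullDim_quotient_eq_zero (by exact_mod_cast hk))
  obtain rfl : r = 1 := by omega
  -- principal centre: the trivial step
  haveI : IsLocalRing (Bsharp p x) := inferInstance
  exact eq_of_isLocalBlowupAlong_of_span_singleton locAtCentre_Bsharp (π := c 0) (by rw [← hcP, range_fin_one]) H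

end OrdWitness

end Summit.ResolutionOfSingularities.ResolutionOfSingularities.Theorems.CleanModels.Negative

end
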